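/-
Copyright (c) 2026 the pub-hodgecm-mathlib formalisation cell (harness21).  Prover seat hodgecm-mathlib-LH4-p12 (g7), req620 Track A «(D-RAM) FOUR-FRAME», line LH4
(STAGE-1b tier-0 regular row, (L-sq) producer (S2b-T) «THE LABELLED TRUNK», glued part OFF the cancellation locus: the LABELLED type-0 κ-SOCKETS on the glued family G1
`(2ρ, 2ρ+s, 2ρ+s)` and the core-hanging family H `(2ρ, 2ρ, 2ρ)` where the level label is CONSTANT on the stratum — ★ κ-sockets (LH4-p08∕p07 lineage, κ: LH4-p05) cut by ★ LH4-p09's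
criteria `latticeInLevel_diagonal_latt_G1_iff_of_ne` ∕ `…_H_iff_of_ne`).  2026-09-04.
-/
import Summits.HodgeConjecture.HodgeConjecture.Theorems.F0P3cDyRamDiagonalKappaGluedSocket         -- ★ (LH4-p05): `finsum_kappaCount_mul_stabiliserWeight_hasAxis_G1`; brings ★ `stratum_G1_eq`
import Summits.HodgeConjecture.HodgeConjecture.Theorems.F0P3cDyRamDiagonalKappaCoreHangingSocket   -- ★ (LH4-p05): `finsum_kappaCount_mul_stabiliserWeight_hasAxis_H`; brings ★ `stratum_H_eq`
import Summits.HodgeConjecture.HodgeConjecture.Theorems.F0P3cDyRamLabelledCoreHangingStratumRead  -- ★ (LH4-p09 (g8)): `latticeInLevel_diagonal_latt_H_iff_of_ne`; brings `…_G1_iff_of_ne`, `finsum_mem_sep_eq_ite_of_forall_iff`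
import HarnessLib

/-!
# Crux `H413`, line LH4 «(D-RAM) FOUR-FRAME» — (S2b-T), glued part off the cancellation locus: THE LABELLED TYPE-0 κ-SOCKETS G1 AND H

Companion of ★ `F0P3cDyRamLabelledKappaSplitSockets` (the four split families).  On the glued family G1 (axis `(2ρ, 2ρ+s, 2ρ+s)`, members
`latt(1,0,0; x,ϖ^ρ,0; xζ+y'', ϖ^ρζ, ϖ^{2ρ+s})` with `|x| = |ζ| = 1`, `|y''| = |ϖ|^s`, ★ `stratum_G1_eq`) and on the core-hanging family H (axis `(2ρ,2ρ,2ρ)`, the same form with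
`s = 0`, `|y''| = 1`, ★ `stratum_H_eq`) the level label `diag(e)·M ⊆ ϖ^ℓ·M` reads (★ LH4-p09 `latticeInLevel_diagonal_latt_G1_iff`) as three constant conditions plus the MIXED
condition `|x·ζ·(e₂ − e₁) + (e₂ − e₀)·y''| ≤ |ϖ|^{ℓ+2ρ+s}`, which is constant on the stratum exactly OFF THE CANCELLATION LOCUS `|e₂ − e₁| ≠ |e₂ − e₀|·|ϖ|^s` (★ LH4-p09
`…_G1_iff_of_ne` ∕ `…_H_iff_of_ne`).  There the labelled κ-socket is the unlabelled ★ κ-socket times the label indicator (★ LH4-p09 `finsum_mem_sep_eq_ite_of_forall_iff`):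

* `finsum_kappaCount_mul_stabiliserWeight_stratum_G1_sep_latticeInLevel_of_ne` — labelled κ-G1 off the locus.
* `finsum_kappaCount_mul_stabiliserWeight_stratum_H_sep_latticeInLevel_of_ne` — labelled κ-H off the locus.

For the label of record `e = ((α−1)², (β−1)², 0)` of the (L-sq) law (`|e₀| = |ϖ|^{2n₂}`, `|e₁| = |ϖ|^{2n₁}`, `e₂ = 0`) the locus is `2n₁ = 2n₂ + s` on G1 and `n₁ = n₂` on H: the
rotated families G2∕G3 (via ★ LH4-p09's permutation transport), the ON-locus tubes (the κ-twins of ★ LH4-p09 `LabelledGluedLocusCensus(Foot)` ∕ `LabelledGluedClassCut` ∕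
`LabelledCoreHangingLocusCensus(Closed)`) and the labelled κ-box-sum are separate files of the labelled trunk.

HONEST LABEL: helper lane (`--supports stmt-HodgeConjecture-24833`), count-neutral; two per-stratum census identities in diagonal-model currency; pays no tier-0 row by itself
(T₊∕T₋∕reg OPEN; the labelled trunk stays OPEN); HC_CM is proved only modulo the 7 printed citations (2 remaining named inputs: hLiu418 = stmt-HodgeConjecture-24832, h413 =
stmt-HodgeConjecture-24833) until rung 0 closes.

## References (NEVER `[KR2]`)
* [Kottwitz1986BaseChangeUnits] R. E. Kottwitz, *Base change for unit elements of Hecke algebras*, Compositio Math. 60 (1986), §1 pp. 240–241.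
* [Rogawski1990] J. D. Rogawski, *Automorphic Representations of Unitary Groups in Three Variables*, Ann. of Math. Stud. 123 (1990), §4.9 Prop. 4.9.1 (a) p. 55, §4.10 p. 58.
* [LanglandsShelstad1987] R. P. Langlands, D. Shelstad, *On the definition of transfer factors*, Math. Ann. 278 (1987), §3.
* [Serre1980Trees] J.-P. Serre, *Trees*, Springer (1980), Ch. II §1.1.
-/

set_option autoImplicit false

noncomputable section

namespace Summit.HodgeConjecture.HodgeConjecture.Cruxes.H413.F0P3cDyRamLabelledKappaGluedSocketsOffLocus

open Matrix
open Literature.NumberTheory.Automorphic Literature.NumberTheory.Automorphic.HermitianLattice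
open Literature.NumberTheory.Automorphic.UnitaryLatticeTree Literature.NumberTheory.Automorphic.UnitaryThreeFourFrame
open Literature.NumberTheory.LocalFields Literature.NumberTheory.LocalFields.WildQuadraticDatum
open Summit.HodgeConjecture.HodgeConjecture.Cruxes.H413.F0P3cDyRamDiagonalTorusDefs
open Summit.HodgeConjecture.HodgeConjecture.Cruxes.H413.F0P3cDyRamDiagonalStrataDefs
open Summit.HodgeConjecture.HodgeConjecture.Cruxes.H413.F0P3cDyRamDiagonalKappaCountDefs
open Summit.HodgeConjecture.HodgeConjecture.Cruxes.H413.F0P3cDyRamDiagonalGluedStratum (stratum_G1_eq)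
open Summit.HodgeConjecture.HodgeConjecture.Cruxes.H413.F0P3cDyRamDiagonalCoreHangingSocket (stratum_H_eq)
open Summit.HodgeConjecture.HodgeConjecture.Cruxes.H413.F0P3cDyRamDiagonalKappaGluedSocket (finsum_kappaCount_mul_stabiliserWeight_hasAxis_G1)
open Summit.HodgeConjecture.HodgeConjecture.Cruxes.H413.F0P3cDyRamDiagonalKappaCoreHangingSocket (finsum_kappaCount_mul_stabiliserWeight_hasAxis_H)
open Summit.HodgeConjecture.HodgeConjecture.Cruxes.H413.F0P3cDyRamFourFrameCensusDefs
open Summit.HodgeConjecture.HodgeConjecture.Cruxes.H413.F0P3cDyRamLabelledSplitStrata (finsum_mem_sep_eq_ite_of_forall_iff)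
open Summit.HodgeConjecture.HodgeConjecture.Cruxes.H413.F0P3cDyRamLabelledGluedStratumRead (latticeInLevel_diagonal_latt_G1_iff_of_ne)
open Summit.HodgeConjecture.HodgeConjecture.Cruxes.H413.F0P3cDyRamLabelledCoreHangingStratumRead (latticeInLevel_diagonal_latt_H_iff_of_ne)
open scoped Valued WithZero Matrix MatrixGroups

variable {K : Type} [Field K] [Valued K ℤᵐ⁰] [CompleteSpace K] [Fintype 𝓀[K]] {σ : K →+* K} {ϖ : K} {d t : ℕ} {α β : K} {N₀ n₁ n₂ n₃ : ℕ}
  {T : GL (Fin 3) K}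

/-- **LABELLED κ-G1 `(2ρ, 2ρ+s, 2ρ+s)` OFF THE CANCELLATION LOCUS** (`ρ, s ≥ 1`, a σ-fixed glue witness `f₀` of foot 0 as in ★ `finsum_kappaCount_mul_stabiliserWeight_hasAxis_G1`,
and `|e₂ − e₁| ≠ |e₂ − e₀|·|ϖ|^s`): `Σᶠ_{M ∈ stratum, diag(e)·M ⊆ ϖ^ℓ·M} κ₀,ᵢ(M)·w(M)` = the ★ unlabelled κ-G1 closed form (free part + glued-foot part at `f₀`) if the constant label
condition `(∀ j, |e_j| ≤ |ϖ|^ℓ) ∧ |e₁ − e₀| ≤ |ϖ|^{ℓ+ρ} ∧ |e₂ − e₁| ≤ |ϖ|^{ℓ+ρ+s} ∧ (|e₂ − e₁| ≤ |ϖ|^{ℓ+2ρ+s} ∧ |e₂ − e₀|·|ϖ|^s ≤ |ϖ|^{ℓ+2ρ+s})` holds, else `0`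
(★ `stratum_G1_eq`, ★ LH4-p09 `latticeInLevel_diagonal_latt_G1_iff_of_ne`, ★ `finsum_mem_sep_eq_ite_of_forall_iff`). [cite: Kottwitz1986BaseChangeUnits, §1 pp. 240–241]
[cite: Rogawski1990, §4.9 Prop. 4.9.1 (a) p. 55; §4.10 p. 58] [cite: LanglandsShelstad1987, §3] -/
theorem finsum_kappaCount_mul_stabiliserWeight_stratum_G1_sep_latticeInLevel_of_ne (hD : IsRamifiedQuadraticDatum σ ϖ d t) (h2 : Valued.v (2 : K) < 1)
    (hE : IsElementDatum σ ϖ N₀ α β n₁ n₂ n₃) (hN₀ : d ≤ N₀) (hT : (T : Matrix (Fin 3) (Fin 3) K) = Matrix.diagonal ![α, β, 1])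
    (ρ s : ℕ) (hρ : 1 ≤ ρ) (hs : 1 ≤ s) (i : Fin 3) (f₀ : K) (hf₀ : σ f₀ = f₀)
    (hglue : 2 ∣ s → n₂ = n₃ → n₁ = n₂ + s → n₂ < 2 * ρ → 2 * ρ - n₂ ≤ n₂ - d + 1 → Valued.v (f₀ + (β - 1) / (α - 1)) ≤ Valued.v ϖ ^ (2 * ρ + s - n₂))
    (ℓ : ℕ) (e : Fin 3 → K) (hne : Valued.v (e 2 - e 1) ≠ Valued.v (e 2 - e 0) * Valued.v ϖ ^ s) :
    ∑ᶠ M ∈ {M | M ∈ stratum σ ϖ T ![2 * ρ, 2 * ρ + s, 2 * ρ + s] ∧ LatticeInLevel ϖ ℓ (Matrix.diagonal e) M},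
        (kappaCount σ ϖ 0 i M : ℚ) * stabiliserWeight σ M =
      if ((Valued.v (e 0) ≤ Valued.v ϖ ^ ℓ ∧ Valued.v (e 1) ≤ Valued.v ϖ ^ ℓ ∧ Valued.v (e 2) ≤ Valued.v ϖ ^ ℓ) ∧
          Valued.v (e 1 - e 0) ≤ Valued.v ϖ ^ (ℓ + ρ) ∧ Valued.v (e 2 - e 1) ≤ Valued.v ϖ ^ (ℓ + ρ + s) ∧
            (Valued.v (e 2 - e 1) ≤ Valued.v ϖ ^ (ℓ + 2 * ρ + s) ∧ Valued.v (e 2 - e 0) * Valued.v ϖ ^ s ≤ Valued.v ϖ ^ (ℓ + 2 * ρ + s))) then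
        ((if 2 ∣ s ∧ 2 * ρ ≤ min n₂ n₃ ∧ 2 * ρ + s ≤ n₁ then
            (![(normSign σ (-1 : K) : ℚ) * (Fintype.card 𝓀[K] : ℚ) ^ (2 * ρ + s / 2 - 1) *
                ((if 2 * d ≤ s then (Fintype.card 𝓀[K] : ℚ) - 1 else 0) - (if s + 2 = 2 * d then 1 else 0)), 0, 0] : Fin 3 → ℚ) i
          else 0) +
        (if 2 ∣ s ∧ n₂ = n₃ ∧ n₁ = n₂ + s ∧ n₂ < 2 * ρ ∧ 2 * ρ - n₂ ≤ n₂ - d + 1 then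
            (![if 2 * d ≤ s + 2 * ((2 * ρ - n₂ + 1) / 2) then (normSign σ (-1 : K) : ℚ) * normSign σ (1 + f₀) else 0,
               if d ≤ (2 * ρ - n₂ + 1) / 2 then (normSign σ (-1 : K) : ℚ) * normSign σ f₀ * normSign σ (1 + f₀) else 0,
               if d ≤ (2 * ρ - n₂ + 1) / 2 then (normSign σ f₀ : ℚ) else 0] : Fin 3 → ℚ) i *
              (Fintype.card 𝓀[K] : ℚ) ^ (2 * ρ + s / 2 - (2 * ρ - n₂ + 1) / 2)
          else 0))
      else 0 := by
  classical
  have hvσ : ∀ a, Valued.v (σ a) = Valued.v a := hD.2.1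
  have hϖ : Valued.v ϖ = WithZero.exp (-1 : ℤ) := hD.2.2.1
  have hfix : ∀ x : K, σ x = x → x ≠ 0 → ∃ n : ℤ, Valued.v x = WithZero.exp (2 * n) := hD.2.2.2.1
  have hϖ0 : ϖ ≠ 0 := fun h0 => by rw [h0, map_zero] at hϖ; exact WithZero.coe_ne_zero hϖ.symm
  rw [finsum_mem_sep_eq_ite_of_forall_iff (stratum σ ϖ T ![2 * ρ, 2 * ρ + s, 2 * ρ + s]) _ _ (fun M hM => by
    rw [stratum_G1_eq hvσ hfix hϖ T hρ hs] at hM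
    obtain ⟨x, ζ, y'', hx, hζ, hy, rfl, -, -⟩ := hM
    exact latticeInLevel_diagonal_latt_G1_iff_of_ne hϖ0 ℓ ρ s e hx hζ hy hne),
    finsum_kappaCount_mul_stabiliserWeight_hasAxis_G1 hD h2 hE hN₀ hT ρ s hρ hs i f₀ hf₀ hglue]

/-- **LABELLED κ-H `(2ρ, 2ρ, 2ρ)` OFF THE CANCELLATION LOCUS** (`ρ ≥ 1`, a σ-fixed glue witness `f₀` as in ★ `finsum_kappaCount_mul_stabiliserWeight_hasAxis_H`, and
`|e₂ − e₁| ≠ |e₂ − e₀|`): `Σᶠ_{M ∈ stratum, diag(e)·M ⊆ ϖ^ℓ·M} κ₀,ᵢ(M)·w(M)` = the ★ unlabelled κ-H closed form (the hanging part at `f₀`; the free part is κ-null) if the constant label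
condition `(∀ j, |e_j| ≤ |ϖ|^ℓ) ∧ |e₁ − e₀| ≤ |ϖ|^{ℓ+ρ} ∧ |e₂ − e₁| ≤ |ϖ|^{ℓ+ρ} ∧ (|e₂ − e₁| ≤ |ϖ|^{ℓ+2ρ} ∧ |e₂ − e₀| ≤ |ϖ|^{ℓ+2ρ})` holds, else `0` (★ `stratum_H_eq`, ★ LH4-p09
`latticeInLevel_diagonal_latt_H_iff_of_ne`, ★ `finsum_mem_sep_eq_ite_of_forall_iff`). [cite: Kottwitz1986BaseChangeUnits, §1 pp. 240–241]
[cite: Rogawski1990, §4.9 Prop. 4.9.1 (a) p. 55; §4.10 p. 58] [cite: LanglandsShelstad1987, §3] -/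
theorem finsum_kappaCount_mul_stabiliserWeight_stratum_H_sep_latticeInLevel_of_ne (hD : IsRamifiedQuadraticDatum σ ϖ d t) (h2 : Valued.v (2 : K) < 1)
    (hE : IsElementDatum σ ϖ N₀ α β n₁ n₂ n₃) (hN₀ : d ≤ N₀) (hT : (T : Matrix (Fin 3) (Fin 3) K) = Matrix.diagonal ![α, β, 1]) (ρ : ℕ) (hρ : 1 ≤ ρ)
    (i : Fin 3) (f₀ : K) (hσf₀ : σ f₀ = f₀)
    (hf₀ : n₁ = n₂ → n₂ = n₃ → n₁ < 2 * ρ → 2 * ρ - n₁ ≤ n₁ - d + 1 → Valued.v (f₀ + (β - 1) / (α - 1)) ≤ Valued.v ϖ ^ (2 * ρ - n₁))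
    (ℓ : ℕ) (e : Fin 3 → K) (hne : Valued.v (e 2 - e 1) ≠ Valued.v (e 2 - e 0)) :
    ∑ᶠ M ∈ {M | M ∈ stratum σ ϖ T ![2 * ρ, 2 * ρ, 2 * ρ] ∧ LatticeInLevel ϖ ℓ (Matrix.diagonal e) M}, (kappaCount σ ϖ 0 i M : ℚ) * stabiliserWeight σ M =
      if ((Valued.v (e 0) ≤ Valued.v ϖ ^ ℓ ∧ Valued.v (e 1) ≤ Valued.v ϖ ^ ℓ ∧ Valued.v (e 2) ≤ Valued.v ϖ ^ ℓ) ∧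
          Valued.v (e 1 - e 0) ≤ Valued.v ϖ ^ (ℓ + ρ) ∧ Valued.v (e 2 - e 1) ≤ Valued.v ϖ ^ (ℓ + ρ) ∧
            (Valued.v (e 2 - e 1) ≤ Valued.v ϖ ^ (ℓ + 2 * ρ) ∧ Valued.v (e 2 - e 0) ≤ Valued.v ϖ ^ (ℓ + 2 * ρ))) then
        (if n₁ = n₂ ∧ n₂ = n₃ ∧ n₁ < 2 * ρ ∧ 2 * ρ - n₁ ≤ n₁ - d + 1 ∧ d ≤ (2 * ρ - n₁ + 1) / 2
          then (((![normSign σ (-(1 + f₀)), normSign σ f₀ * normSign σ (-(1 + f₀)), normSign σ f₀] : Fin 3 → ℤ) i : ℤ) : ℚ) *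
            (Fintype.card 𝓀[K] : ℚ) ^ (2 * ρ - (2 * ρ - n₁ + 1) / 2)
          else 0)
      else 0 := by
  classical
  have hvσ : ∀ a, Valued.v (σ a) = Valued.v a := hD.2.1
  have hϖ : Valued.v ϖ = WithZero.exp (-1 : ℤ) := hD.2.2.1
  have hfix : ∀ x : K, σ x = x → x ≠ 0 → ∃ n : ℤ, Valued.v x = WithZero.exp (2 * n) := hD.2.2.2.1
  have hϖ0 : ϖ ≠ 0 := fun h0 => by rw [h0, map_zero] at hϖ; exact WithZero.coe_ne_zero hϖ.symm
  rw [finsum_mem_sep_eq_ite_of_forall_iff (stratum σ ϖ T ![2 * ρ, 2 * ρ, 2 * ρ]) _ _ (fun M hM => by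
    rw [stratum_H_eq hvσ hfix hϖ T hρ] at hM
    obtain ⟨-, -, x, ζ, y'', hx, hζ, hy, -, rfl⟩ := hM
    exact latticeInLevel_diagonal_latt_H_iff_of_ne hϖ0 ℓ ρ e hx hζ hy hne),
    finsum_kappaCount_mul_stabiliserWeight_hasAxis_H hD h2 hE hN₀ hT ρ hρ i f₀ hσf₀ hf₀]

end Summit.HodgeConjecture.HodgeConjecture.Cruxes.H413.F0P3cDyRamLabelledKappaGluedSocketsOffLocus

end
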